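import Summits.Ventures.YMGap.StrongCouplingGapShape
import Literature.MathematicalPhysics.QuantumFieldTheory.Balaban1983to89.StrongCouplingDobrushinWindow
import Summits.QuantumFields.BalabanUV.InfraRed.StrongCouplingPoincareDoorSUN
import Summits.QuantumFields.BalabanUV.InfraRed.StrongCouplingFluxCovariance
import HarnessLib

/-!
# Venture YMGap — track (a): the mass gap at a given coupling FROM a one-link certificate, and the
# dictionary onto the tree's strong-coupling front (`DLRMassGapAt`, `OneLinkKRModulus`, `OneLinkPoincareSUN`)

HONEST FRAMING: venture file (cell `pub-ymgap`). Strong-coupling LATTICE regime only; no continuum or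
Clay claim; no new threshold is produced in this file. It (1) identifies the venture's typed target
`MassGapAt d N β` (`StrongCouplingGapShape`, verbatim the `β`-body of the registered fact `shen_zhu_zhu`)
with the SC-a currency `DLRMassGapAt d N β` of the tree's strong-coupling front
(`Balaban1983to89.StrongCouplingDobrushinWindow`, cell `pub-balaban`) — `massGapAt_iff_dlrMassGapAt` —
and the venture's `OneLinkPoincareBound N b k` with the front's schema `OneLinkPoincareSUN N b (1/(N k))`;
(2) re-runs, with the threshold symbolic, the tree's two Dobrushin reductions so that the GENERAL-WEIGHT
certificate `OneLinkKRCertificate d N β` (arbitrary bounded weight `r`, non-uniform influence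
coefficients — the shape a weighted / LP-searched witness has) and a one-link Poincaré constant on a ball
each yield `MassGapAt d N β`; (3) records the BAR the cell has to beat in this currency: the tree already
proves, hypothesis-free, `DLRMassGapAt 4 2 (β_W/4)` for every Wilson `0 ≤ β_W < 2/9`
(`StrongCouplingFluxCovariance.su2_dlrMassGapAt`), i.e. `MassGapOnWindow 4 2 0 (1/18)` in 't Hooft units
(`su2_massGapOnWindow_twoNinths`), against Shen–Zhu–Zhu's `|β| < 1/48` (`β_W < 1/12`). An "improved
threshold" for `SU(2)`, `d = 4` in THIS currency therefore means `β_W ≥ 2/9`; the single-site door is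
closed there by theorem (`StrongCouplingDobrushinFloor.su2_dobrushinDoor_ceiling`), so only block
(Dobrushin–Shlosman) witnesses can move it — not typed here.

* `massGapAt_iff_dlrMassGapAt`, `oneLinkPoincareBound_iff_oneLinkPoincareSUN` — dictionary.
* `massGapAt_of_oneLinkKRCertificate` — Dobrushin's condition (Vasserstein form, general weight) at `β`
  ⟹ `MassGapAt d N β` (Dobrushin 1970; Föllmer 1988 Ch. I §2; proof = the tree's
  `shen_zhu_zhu_of_dobrushinCondition` at one coupling).
* `massGapAt_of_oneLinkKRModulus` — the front's kernel theorem `dlrMassGapAt_of_oneLinkKRModulus` read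
  through the dictionary.
* `massGapAt_of_oneLinkPoincareBound` — a one-link Poincaré constant `N k` on the ball `‖B‖_op ≤ 2(d-1)|β|`
  with `6(d-1)|β| < k` ⟹ `MassGapAt d N β` (perturbation lemma `abs_integral_tilted_add_sub_le`; the
  Dobrushin row sum is `6(d-1)|β|/k`; with `k = 1/2 - 2(d-1)|β|` this is Shen–Zhu–Zhu's window).
* `massGapBelow_of_poincareProfile`, `improvedThreshold_of_poincareProfile`, `shen_zhu_zhu_of_szzProfile`
  (the Bakry–Émery profile `k(b) = 1/2 - b` returns exactly the registered `shen_zhu_zhu d N`).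
* `MassGapOnWindow d N a b` (one-sided windows `a ≤ β < b`, the form in which the tree's `SU(2)`/`SU(3)`
  fronts are stated) and `su2_massGapOnWindow_twoNinths`.

References: Shen–Zhu–Zhu, CMP 400 (2023) 805, Assumption 1.1, Thm. 1.2, Rem. 1.3 ff., Lemma 4.1,
(4.4)–(4.6), Cor. 1.4; Dobrushin, Theory Probab. Appl. 15 (1970) 458; Föllmer, LNM 1362 (1988) Ch. I §2;
the tree files named above (cell `pub-balaban`, `run/shared/lean/pub/pub-balaban/ir/FRONT-SC.md`).
-/

noncomputable section

open MeasureTheory ProbabilityTheory Filter Function Real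
open scoped NNReal Matrix
open Literature.MathematicalPhysics
open Literature.Probability.LatticeModels
open Literature.Probability.LatticeModels.DobrushinMetric
open Literature.MathematicalPhysics.QuantumLattice
open Literature.MathematicalPhysics.QuantumFieldTheory
open Literature.MathematicalPhysics.QuantumFieldTheory.Balaban1983to89.StrongCouplingDobrushinWindow
open Summit.QuantumFields.BalabanUV.InfraRed.StrongCouplingPoincareDoorSUN (OneLinkPoincareSUN)
open Summit.QuantumFields.BalabanUV.InfraRed.StrongCouplingFluxCovariance (su2_dlrMassGapAt)

namespace Summit.Ventures.YMGap

variable {d N : ℕ}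

/-! ## Dictionary onto the tree's strong-coupling front -/

/-- **`MassGapAt` is the SC-a currency `DLRMassGapAt`.** The two predicates differ only in the order of
the quantifiers `∀ μ ∈ 𝒢` / `∃ rate > 0`; since both assert `|𝒢| = 1` they are equivalent (the rate of the
unique DLR state serves for all). -/
theorem massGapAt_iff_dlrMassGapAt {β : ℝ} : MassGapAt d N β ↔ DLRMassGapAt d N β := by
  constructor
  · rintro ⟨huniq, hclust⟩
    refine ⟨huniq, ?_⟩
    obtain ⟨μ₀, hμ₀⟩ := huniq.2
    obtain ⟨c, hc, hcμ₀⟩ := hclust μ₀ hμ₀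
    refine ⟨c, hc, fun μ hμ n => ?_⟩
    have hμeq : μ = μ₀ := huniq.1 hμ hμ₀
    subst hμeq
    exact hcμ₀ n
  · rintro ⟨huniq, m, hm, hclust⟩
    exact ⟨huniq, fun μ hμ => ⟨m, hm, fun n => hclust μ hμ n⟩⟩

/-- **`OneLinkPoincareBound N b k` is the front's schema `OneLinkPoincareSUN N b (1/(N k))`** (variance
`≤ M²/(N k)` versus `≤ c M²` with `c = 1/(N k)`). -/
theorem oneLinkPoincareBound_iff_oneLinkPoincareSUN {b k : ℝ} :
    OneLinkPoincareBound N b k ↔ OneLinkPoincareSUN N b (1 / ((N : ℝ) * k)) := by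
  have hrw : ∀ M : ℝ, M ^ 2 / ((N : ℝ) * k) = 1 / ((N : ℝ) * k) * M ^ 2 := fun M => by ring
  constructor
  · intro h B hB ψ M hM hψ
    rw [← hrw]
    exact h B hB ψ M hM hψ
  · intro h B hB ψ M hM hψ
    rw [hrw]
    exact h B hB ψ M hM hψ

/-- **The front's kernel theorem through the dictionary**: a one-link Kantorovich–Rubinstein modulus `K`
on a ball of radius `R ≥ 2(d-1)|β|` with Dobrushin constant `6(d-1)|β|K < 1` gives `MassGapAt d N β`
(`dlrMassGapAt_of_oneLinkKRModulus`, cell `pub-balaban`). -/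
theorem massGapAt_of_oneLinkKRModulus (hd : 2 ≤ d) (hN : 2 ≤ N) {β R K : ℝ} (hK : 0 ≤ K)
    (hR : |β| * (2 * ((d : ℝ) - 1)) ≤ R) (hmod : OneLinkKRModulus N R K)
    (hsmall : 6 * ((d : ℝ) - 1) * |β| * K < 1) : MassGapAt d N β :=
  massGapAt_iff_dlrMassGapAt.2 (dlrMassGapAt_of_oneLinkKRModulus hd hN hK hR hmod hsmall)

/-- **One-sided coupling windows.** `MassGapOnWindow d N a b`: `MassGapAt d N β` for every `a ≤ β < b`
('t Hooft units). The tree's hypothesis-free `SU(2)`/`SU(3)` fronts are stated for `0 ≤ β_W`, i.e. in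
this one-sided form, whereas `MassGapBelow` (Shen–Zhu–Zhu's `|β| < β₀`) is two-sided. -/
def MassGapOnWindow (d N : ℕ) (a b : ℝ) : Prop :=
  ∀ β : ℝ, a ≤ β → β < b → MassGapAt d N β

/-- A two-sided window gives the one-sided one. -/
theorem MassGapBelow.onWindow {β₀ : ℝ} (h : MassGapBelow d N β₀) : MassGapOnWindow d N 0 β₀ :=
  fun β h0 hβ => h β (by rwa [abs_of_nonneg h0])

/-- **THE BAR IN THIS CURRENCY (`SU(2)`, `d = 4`).** The tree proves, hypothesis-free, the DLR mass gap of
`SU(2)` lattice Yang–Mills on `ℤ⁴` for every Wilson coupling `0 ≤ β_W < 2/9`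
(`StrongCouplingFluxCovariance.su2_dlrMassGapAt`, cell `pub-balaban`, certificate J-SC16); in 't Hooft
units (`β_W = N² β = 4β`) that is the window `0 ≤ β < 1/18`, against Shen–Zhu–Zhu's `|β| < 1/48`. Any
track-(a) "improved threshold" for `SU(2)`, `d = 4` in currency SC-a has to exceed `β_W = 2/9`. -/
theorem su2_massGapOnWindow_twoNinths : MassGapOnWindow 4 2 0 (1 / 18) := by
  intro β h0 hβ
  have h := su2_dlrMassGapAt (βW := 4 * β) (by linarith) (by linarith)
  have h4 : 4 * β / 4 = β := by ring
  rw [h4] at h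
  exact massGapAt_iff_dlrMassGapAt.2 h

/-! ## The general-weight Dobrushin certificate and the Poincaré profile -/



/-- **Mass gap at `β` from Dobrushin's condition for the one-link laws at `β`.** The proof is the
tree's `shen_zhu_zhu_of_dobrushinCondition` with the coupling fixed instead of quantified:
uniqueness by `subsingleton_gibbsMeasures_of_isKRContraction` (existence by compactness,
`shen_zhu_zhu_nonempty`), clustering by `abs_covariance_le_of_isKRContraction` with the profile
`⌊dist(·, Λ₂)⌋`, rate `κ = -log max(c, 1/2)`, constant `c₁ = 2R²A²n²e^{κ}`. -/
theorem massGapAt_of_oneLinkKRCertificate (hd : 2 ≤ d) (_hN : 2 ≤ N) {β : ℝ}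
    (hcert : OneLinkKRCertificate d N β) : MassGapAt d N β := by
  obtain ⟨r, R, A, c, C, hr0, hrR, hA0, hA, hC0, hc1, hrow, hcontr⟩ := hcert
  haveI : SecondCountableTopology (Matrix (Fin N) (Fin N) ℂ) :=
    inferInstanceAs (SecondCountableTopology (Fin N → Fin N → ℂ))
  haveI : SecondCountableTopology (Matrix.specialUnitaryGroup (Fin N) ℂ) :=
    Topology.IsEmbedding.subtypeVal.secondCountableTopology
  have hγ : IsSpecification (ymSpecification (d := d) (fundamentalRep (Fin N)) (N * β)) :=
    isSpecification_ymSpecification_of_t2Space _ (continuous_fundamentalRep (Fin N)) _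
  have hKR : IsKRContraction (ymSpecification (d := d) (fundamentalRep (Fin N)) (N * β)) r
      linkPlaqNbr C :=
    isKRContraction_ymSpecification _ (continuous_fundamentalRep (Fin N)) _ hC0 hcontr
  have hd0 : 0 < d := by omega
  have e₀ : QuantumLattice.ZdEdge d := (0, ⟨0, hd0⟩)
  have hc0 : 0 ≤ c := (Finset.sum_nonneg fun y _ => hC0 e₀ y).trans (hrow e₀)
  have hR : 0 ≤ R := (hr0 1 1).trans (hrR 1 1)
  refine ⟨?_, ?_⟩
  · refine (shen_zhu_zhu_hasUniqueGibbsMeasure_iff β).2 ?_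
    exact subsingleton_gibbsMeasures_of_isKRContraction hγ hKR hr0 hrR suEntries
      measurableSpace_specialUnitaryGroup_eq_comap hA0 hA hc0 hc1 hrow
  · intro μ hμ
    set c' : ℝ := max c (1 / 2) with hc'
    have hc'0 : 0 < c' := lt_max_of_lt_right (by norm_num)
    have hc'1 : c' < 1 := max_lt hc1 (by norm_num)
    have hrow' : ∀ x, ∑ y ∈ linkPlaqNbr x, C x y ≤ c' := fun x => (hrow x).trans (le_max_left _ _)
    set κ : ℝ := -Real.log c' with hκ
    have hκ0 : 0 < κ := neg_pos.2 (Real.log_neg hc'0 hc'1)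
    refine ⟨κ, hκ0, fun n => ⟨2 * R ^ 2 * A ^ 2 * (n : ℝ) ^ 2 * Real.exp κ, ?_⟩⟩
    intro F₁ F₂ Λ₁ Λ₂ K₁ K₂ h₁ h₂ _ hF₁ hF₂
    have hμ' : IsGibbsMeasure (ymSpecification (d := d) (fundamentalRep (Fin N)) (N * β)) μ := hμ
    haveI := hμ'.isProbabilityMeasure
    set ℓ : QuantumLattice.ZdEdge d → ℕ := fun y => ⌊linkSetDist Λ₂ y⌋₊ with hℓ
    have hℓ0 : ∀ y ∈ Λ₂, ℓ y = 0 := fun y hy => by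
      simp [hℓ, linkSetDist_eq_zero_of_mem hy]
    have hℓ1 : ∀ x ∉ Λ₂, ∀ y ∈ linkPlaqNbr x, ℓ x ≤ ℓ y + 1 := fun x _ y hy => by
      calc ℓ x ≤ ⌊linkSetDist Λ₂ y + 1⌋₊ := Nat.floor_mono (linkSetDist_le_add_one hy)
        _ = ℓ y + 1 := Nat.floor_add_one (linkSetDist_nonneg _ _)
    have key := abs_covariance_le_of_isKRContraction hγ hKR hr0 hrR hR hc'0.le hc'1.le hrow' hμ'
      hF₁.measurable hF₁.dependsOn hF₁.abs_le (hF₁.isLipBound hA0 hA)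
      hF₂.measurable hF₂.dependsOn hF₂.abs_le (hF₂.isLipBound hA0 hA) ℓ hℓ0 hℓ1
    have hK₁ : (0 : ℝ) ≤ K₁ := K₁.2
    have hK₂ : (0 : ℝ) ≤ K₂ := K₂.2
    have hn₁ : (Λ₁.card : ℝ) ≤ n := by exact_mod_cast h₁
    have hn₂ : (Λ₂.card : ℝ) ≤ n := by exact_mod_cast h₂
    have hsum₂ : ∑ y ∈ Λ₂, (if y ∈ Λ₂ then A * (K₂ : ℝ) else 0) ≤ n * (A * K₂) := by
      rw [Finset.sum_ite_of_true (fun y hy => hy), Finset.sum_const, nsmul_eq_mul]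
      exact mul_le_mul_of_nonneg_right hn₂ (by positivity)
    have hm : ∀ y ∈ Λ₁, ⌊setDistEdges Λ₁ Λ₂⌋₊ ≤ ℓ y := fun y hy =>
      Nat.floor_mono (setDistEdges_le_linkSetDist hy)
    have hsum₁ : ∑ y ∈ Λ₁, c' ^ ℓ y * (if y ∈ Λ₁ then A * (K₁ : ℝ) else 0) ≤
        n * (c' ^ ⌊setDistEdges Λ₁ Λ₂⌋₊ * (A * K₁)) := by
      calc ∑ y ∈ Λ₁, c' ^ ℓ y * (if y ∈ Λ₁ then A * (K₁ : ℝ) else 0)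
          ≤ ∑ y ∈ Λ₁, c' ^ ⌊setDistEdges Λ₁ Λ₂⌋₊ * (A * K₁) := Finset.sum_le_sum fun y hy => by
            rw [if_pos hy]
            exact mul_le_mul_of_nonneg_right (pow_le_pow_of_le_one hc'0.le hc'1.le (hm y hy))
              (by positivity)
        _ = Λ₁.card * (c' ^ ⌊setDistEdges Λ₁ Λ₂⌋₊ * (A * K₁)) := by
            rw [Finset.sum_const, nsmul_eq_mul]
        _ ≤ n * (c' ^ ⌊setDistEdges Λ₁ Λ₂⌋₊ * (A * K₁)) :=
            mul_le_mul_of_nonneg_right hn₁ (by positivity)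
    have hgeom : c' ^ ⌊setDistEdges Λ₁ Λ₂⌋₊ ≤
        Real.exp κ * Real.exp (-κ * setDistEdges Λ₁ Λ₂) := by
      have hfl : setDistEdges Λ₁ Λ₂ - 1 ≤ (⌊setDistEdges Λ₁ Λ₂⌋₊ : ℝ) := by
        have := Nat.lt_floor_add_one (setDistEdges Λ₁ Λ₂)
        linarith
      rw [← Real.exp_add, ← Real.rpow_natCast, Real.rpow_def_of_pos hc'0]
      refine Real.exp_le_exp.2 ?_
      have hlog : Real.log c' = -κ := by rw [hκ, neg_neg]
      rw [hlog]
      have := mul_le_mul_of_nonneg_left hfl hκ0.le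
      linarith
    have hsD := setDistEdges_nonneg Λ₁ Λ₂
    calc |cov[F₁, F₂; μ]|
        ≤ 2 * R ^ 2 * (∑ y ∈ Λ₂, (if y ∈ Λ₂ then A * (K₂ : ℝ) else 0)) *
            ∑ y ∈ Λ₁, c' ^ ℓ y * (if y ∈ Λ₁ then A * (K₁ : ℝ) else 0) := key
      _ ≤ 2 * R ^ 2 * (n * (A * K₂)) * (n * (c' ^ ⌊setDistEdges Λ₁ Λ₂⌋₊ * (A * K₁))) := by
          refine mul_le_mul (mul_le_mul_of_nonneg_left hsum₂ (by positivity)) hsum₁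
            (Finset.sum_nonneg fun y hy => ?_) (by positivity)
          rw [if_pos hy]; positivity
      _ ≤ 2 * R ^ 2 * (n * (A * K₂)) *
            (n * (Real.exp κ * Real.exp (-κ * setDistEdges Λ₁ Λ₂) * (A * K₁))) := by
          gcongr
      _ = 2 * R ^ 2 * A ^ 2 * (n : ℝ) ^ 2 * Real.exp κ * Real.exp (-κ * setDistEdges Λ₁ Λ₂) *
            ((K₁ : ℝ) * K₂) := by ring
      _ ≤ 2 * R ^ 2 * A ^ 2 * (n : ℝ) ^ 2 * Real.exp κ * Real.exp (-κ * setDistEdges Λ₁ Λ₂) *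
            ((K₁ : ℝ) * K₂ + Real.sqrt (∫ U, F₁ U ^ 2 ∂μ) * Real.sqrt (∫ U, F₂ U ^ 2 ∂μ)) := by
          gcongr
          exact le_add_of_nonneg_right (by positivity)

/-- **Mass gap at `β` from a one-link Poincaré constant.** If the Gibbs-tilted Haar measures
`ν_B ∝ exp(N Re tr(g B))dg` on `SU(N)`, `‖B‖_op ≤ 2(d-1)|β|`, satisfy the Lipschitz Poincaré
inequality `Var(ψ) ≤ M²/(N k)` with `k > 0`, and the Dobrushin row sum `6(d-1)|β|/k` is `< 1`, then
`MassGapAt d N β`. Proof = the tree's `shen_zhu_zhu_of_haarPoincare` with `1/2 - 2(d-1)|β|`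
replaced by `k`: one-link law `= ν_{B_ω}` (`siteLaw_ymSpecification_thooft`), interpolating tilts of
operator norm `≤ 2(d-1)|β|`, perturbation lemma `abs_integral_tilted_add_sub_le`, influence
coefficients `C(x,y) = (|β|/k) n(x,y)`, `∑_y n(x,y) ≤ 6(d-1)`; then
`massGapAt_of_oneLinkKRCertificate` with the Frobenius distance as weight (`R = 2√N`, `A = 1`).
With `k = 1/2 - 2(d-1)|β|` the condition is Shen–Zhu–Zhu's `|β| < 1/(16(d-1))`. -/
theorem massGapAt_of_oneLinkPoincareBound (hd : 2 ≤ d) (hN : 2 ≤ N) {β k : ℝ} (hk : 0 < k)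
    (hLP : OneLinkPoincareBound N (2 * ((d : ℝ) - 1) * |β|) k)
    (hrow : 6 * ((d : ℝ) - 1) * |β| < k) : MassGapAt d N β := by
  classical
  refine massGapAt_of_oneLinkKRCertificate hd hN ?_
  have hd2 : (2 : ℝ) ≤ d := by exact_mod_cast hd
  have hd0 : (0 : ℝ) < (d : ℝ) - 1 := by linarith
  have hN0 : (0 : ℝ) < N := by exact_mod_cast (show 0 < N by omega)
  have hd1' : 1 ≤ d := by omega
  have hN1 : 1 ≤ N := by omega
  set a : ℝ := |β| * (2 * ((d : ℝ) - 1)) with ha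
  have ha' : 2 * ((d : ℝ) - 1) * |β| = a := by rw [ha]; ring
  have ha0 : 0 ≤ a := by positivity
  set κ₁ : ℝ := |β| / k with hκ₁
  have hκ₁0 : 0 ≤ κ₁ := div_nonneg (abs_nonneg β) hk.le
  set K : ℝ := (N : ℝ) * k with hK
  have hKpos : 0 < K := mul_pos hN0 hk
  refine ⟨suFrobDist, 2 * Real.sqrt N, 1, 6 * ((d : ℝ) - 1) * κ₁,
    fun x y => κ₁ * linkInfluence x y, suFrobDist_nonneg, suFrobDist_le, zero_le_one,
    fun a b => by rw [one_mul]; exact dist_suEntries_le_suFrobDist a b,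
    fun x y => by positivity, ?_, ?_, ?_⟩
  · -- the Dobrushin constant `6(d-1)|β|/k < 1`
    rw [hκ₁, ← mul_div_assoc, div_lt_one hk]
    exact hrow
  · -- row sums of the influence coefficients
    intro x
    rw [← Finset.mul_sum]
    have hsum : ∑ y ∈ linkPlaqNbr x, (linkInfluence x y : ℝ) ≤ 6 * ((d : ℝ) - 1) := by
      have h := sum_linkInfluence_le (d := d) x
      calc ∑ y ∈ linkPlaqNbr x, (linkInfluence x y : ℝ)
          = ((∑ y ∈ linkPlaqNbr x, linkInfluence x y : ℕ) : ℝ) := by push_cast; rfl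
        _ ≤ ((6 * (d - 1) : ℕ) : ℝ) := by exact_mod_cast h
        _ = 6 * ((d : ℝ) - 1) := by push_cast [Nat.cast_sub hd1']; ring
    calc κ₁ * ∑ y ∈ linkPlaqNbr x, (linkInfluence x y : ℝ) ≤ κ₁ * (6 * ((d : ℝ) - 1)) :=
          mul_le_mul_of_nonneg_left hsum hκ₁0
      _ = 6 * ((d : ℝ) - 1) * κ₁ := by ring
  · -- the one-link Kantorovich–Rubinstein contraction
    intro x y hy ω η hωη φ L hφm hφb hL hφL
    rw [siteLaw_ymSpecification_thooft β x ω, siteLaw_ymSpecification_thooft β x η]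
    set Bω : Matrix (Fin N) (Fin N) ℂ := stapleField β x ω with hBω
    set Bη : Matrix (Fin N) (Fin N) ℂ := stapleField β x η with hBη
    set f : Matrix.specialUnitaryGroup (Fin N) ℂ → ℝ :=
      fun g => (N : ℝ) * ((g : Matrix (Fin N) (Fin N) ℂ) * Bω).trace.re with hf
    set w : Matrix.specialUnitaryGroup (Fin N) ℂ → ℝ :=
      fun g => (N : ℝ) * ((g : Matrix (Fin N) (Fin N) ℂ) * (Bη - Bω)).trace.re with hw
    have hfw : (fun g : Matrix.specialUnitaryGroup (Fin N) ℂ =>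
        (N : ℝ) * ((g : Matrix (Fin N) (Fin N) ℂ) * Bη).trace.re) = fun g => f g + w g := by
      funext g
      simp only [hf, hw, Matrix.mul_sub, Matrix.trace_sub, Complex.sub_re]
      ring
    rw [hfw, abs_sub_comm]
    set D : ℝ := (N : ℝ) * (|β| * linkInfluence x y * suFrobDist (ω y) (η y)) with hD
    have hD0 : 0 ≤ D := mul_nonneg hN0.le
      (mul_nonneg (mul_nonneg (abs_nonneg β) (Nat.cast_nonneg _)) (suFrobDist_nonneg _ _))
    have hBdiff : frobNorm (Bη - Bω) ≤ |β| * linkInfluence x y * suFrobDist (ω y) (η y) := by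
      rw [frobNorm_sub_comm]
      exact frobNorm_stapleField_sub_le β x y hωη
    have hwD : ∀ a b, |w a - w b| ≤ D * suFrobDist a b := fun a b => by
      simp only [hw]
      rw [← mul_sub, abs_mul, abs_of_nonneg hN0.le, hD, mul_assoc]
      refine mul_le_mul_of_nonneg_left ?_ hN0.le
      calc |((a : Matrix (Fin N) (Fin N) ℂ) * (Bη - Bω)).trace.re -
              ((b : Matrix (Fin N) (Fin N) ℂ) * (Bη - Bω)).trace.re|
          ≤ suFrobDist a b * frobNorm (Bη - Bω) := abs_re_trace_su_mul_sub_le a b _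
        _ ≤ suFrobDist a b * (|β| * linkInfluence x y * suFrobDist (ω y) (η y)) :=
            mul_le_mul_of_nonneg_left hBdiff (suFrobDist_nonneg _ _)
        _ = |β| * linkInfluence x y * suFrobDist (ω y) (η y) * suFrobDist a b := by ring
    have hfm : Measurable f := (continuous_const.mul (continuous_re_trace_su_mul Bω)).measurable
    have hwm : Measurable w :=
      (continuous_const.mul (continuous_re_trace_su_mul (Bη - Bω))).measurable
    have hfb : ∃ C, ∀ s, |f s| ≤ C := ⟨(N : ℝ) * (Real.sqrt N * frobNorm Bω), fun s => by
      simp only [hf]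
      rw [abs_mul, abs_of_nonneg hN0.le]
      exact mul_le_mul_of_nonneg_left (abs_re_trace_su_mul_le s Bω) hN0.le⟩
    have hwb : ∀ s, |w s| ≤ (N : ℝ) * (Real.sqrt N * frobNorm (Bη - Bω)) := fun s => by
      simp only [hw]
      rw [abs_mul, abs_of_nonneg hN0.le]
      exact mul_le_mul_of_nonneg_left (abs_re_trace_su_mul_le s _) hN0.le
    have key := abs_integral_tilted_add_sub_le
      (μ := haarProbability (Matrix.specialUnitaryGroup (Fin N) ℂ))
      (r := suFrobDist) hfm hfb hwm hwb hφm hφb hKpos hL hD0 hφL hwD ?_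
    · refine key.trans (le_of_eq ?_)
      rw [hD, hK, hκ₁]
      field_simp
    · -- the uniform Poincaré bound along the interpolation, supplied by `hLP`
      intro t ht ψ M hψm _hψb hM hψL
      set Bt : Matrix (Fin N) (Fin N) ℂ := Bω + (t : ℂ) • (Bη - Bω) with hBt
      have hft : (fun u : Matrix.specialUnitaryGroup (Fin N) ℂ => f u + t * w u) =
          fun g : Matrix.specialUnitaryGroup (Fin N) ℂ =>
            (N : ℝ) * ((g : Matrix (Fin N) (Fin N) ℂ) * Bt).trace.re := by
        funext g
        simp only [hf, hw, hBt, Matrix.mul_add, Matrix.mul_smul, Matrix.trace_add,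
          Matrix.trace_smul, Complex.add_re, smul_eq_mul, Complex.re_ofReal_mul]
        ring
      have hBt_le : matrixOpNorm Bt ≤ a := by
        have h1 : Bt = ((1 - t : ℝ) : ℂ) • Bω + ((t : ℝ) : ℂ) • Bη := by
          rw [hBt]
          push_cast
          simp only [smul_sub, sub_smul, one_smul]
          abel
        rw [h1]
        calc matrixOpNorm (((1 - t : ℝ) : ℂ) • Bω + ((t : ℝ) : ℂ) • Bη)
            ≤ matrixOpNorm (((1 - t : ℝ) : ℂ) • Bω) + matrixOpNorm (((t : ℝ) : ℂ) • Bη) :=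
              matrixOpNorm_add_le _ _
          _ = (1 - t) * matrixOpNorm Bω + t * matrixOpNorm Bη := by
              rw [matrixOpNorm_smul, matrixOpNorm_smul, Complex.norm_real, Complex.norm_real,
                Real.norm_eq_abs, Real.norm_eq_abs, abs_of_nonneg (by linarith [ht.2]),
                abs_of_nonneg ht.1]
          _ ≤ (1 - t) * a + t * a :=
              add_le_add
                (mul_le_mul_of_nonneg_left (matrixOpNorm_stapleField_le hd1' hN1 β x ω)
                  (by linarith [ht.2]))
                (mul_le_mul_of_nonneg_left (matrixOpNorm_stapleField_le hd1' hN1 β x η) ht.1)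
          _ = a := by ring
      have hvar := hLP Bt (ha' ▸ hBt_le) ψ M hM hψL
      rw [← hft, variance_eq_integral hψm.aemeasurable] at hvar
      exact hvar

/-- **A certified Poincaré PROFILE closes a window.** If on every coupling `|β| < β₀` one has a
positive one-link Poincaré constant `k(2(d-1)|β|)` beating the Dobrushin row sum `6(d-1)|β|`, then
`MassGapBelow d N β₀`. This is the form in which the cell's track-(a) certificate (a verified lower
profile `k` on `[0, 2(d-1)β₀)`) is consumed. -/
theorem massGapBelow_of_poincareProfile (hd : 2 ≤ d) (hN : 2 ≤ N) {β₀ : ℝ} (k : ℝ → ℝ)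
    (hprof : ∀ β : ℝ, |β| < β₀ →
      0 < k (2 * ((d : ℝ) - 1) * |β|) ∧
        OneLinkPoincareBound N (2 * ((d : ℝ) - 1) * |β|) (k (2 * ((d : ℝ) - 1) * |β|)) ∧
        6 * ((d : ℝ) - 1) * |β| < k (2 * ((d : ℝ) - 1) * |β|)) :
    MassGapBelow d N β₀ := fun β hβ =>
  let ⟨hk, hLP, hrow⟩ := hprof β hβ
  massGapAt_of_oneLinkPoincareBound hd hN hk hLP hrow

/-- **The cell's target from a profile**: if moreover `β₀' > 1/(16(d-1))`, the profile certifies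
`ImprovedThreshold d N β₀'`. -/
theorem improvedThreshold_of_poincareProfile (hd : 2 ≤ d) (hN : 2 ≤ N) {β₀' : ℝ}
    (hβ₀' : 1 / (16 * ((d : ℝ) - 1)) < β₀') (k : ℝ → ℝ)
    (hprof : ∀ β : ℝ, |β| < β₀' →
      0 < k (2 * ((d : ℝ) - 1) * |β|) ∧
        OneLinkPoincareBound N (2 * ((d : ℝ) - 1) * |β|) (k (2 * ((d : ℝ) - 1) * |β|)) ∧
        6 * ((d : ℝ) - 1) * |β| < k (2 * ((d : ℝ) - 1) * |β|)) :
    ImprovedThreshold d N β₀' :=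
  ⟨hβ₀', massGapBelow_of_poincareProfile hd hN k hprof⟩

/-- **Consistency with the tree: the Bakry–Émery profile `k(b) = 1/2 - b` gives back exactly
Shen–Zhu–Zhu's window.** If `OneLinkPoincareBound N b (1/2 - b)` holds for every `b < 1/2`
(Shen–Zhu–Zhu Assumption 1.1 / (4.6) for one link, `Ric = N/2`, `|Hess| ≤ N b`), then the tree's
named fact `shen_zhu_zhu d N` follows (`6(d-1)|β| < 1/2 - 2(d-1)|β| ⟺ |β| < 1/(16(d-1))`). -/
theorem shen_zhu_zhu_of_szzProfile
    (hBE : 2 ≤ N → ∀ b : ℝ, b < 1 / 2 → OneLinkPoincareBound N b (1 / 2 - b)) :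
    shen_zhu_zhu d N := by
  refine shen_zhu_zhu_iff_massGapBelow.2 fun hd hN => ?_
  refine massGapBelow_of_poincareProfile hd hN (fun b => 1 / 2 - b) fun β hβ => ?_
  have hd2 : (2 : ℝ) ≤ d := by exact_mod_cast hd
  have hd0 : (0 : ℝ) < (d : ℝ) - 1 := by linarith
  have hβ' : |β| * (16 * ((d : ℝ) - 1)) < 1 := by
    rwa [lt_div_iff₀ (by positivity)] at hβ
  have h8 : 8 * ((d : ℝ) - 1) * |β| < 1 / 2 := by nlinarith [abs_nonneg β]
  refine ⟨by nlinarith [abs_nonneg β], hBE hN _ (by nlinarith [abs_nonneg β]), by linarith⟩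

end Summit.Ventures.YMGap
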